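import Summits.HodgeConjecture.HodgeConjecture.Theorems.K2E1bCubicCasimirDefs
import Literature.RepresentationTheory.BorelWallach2000.UpqTypeFunctoriality
import HarnessLib

/-!
# K2 ∕ E1b — LAWS BRICK U8-4c-A «the cubic Gelfand invariant is central; the cubic pin is a class invariant»

Cell hodgecm-mathlib, Track B «K2-LIT», engine E1b, unit U8 «archimedean packet signs»; crux item h413 = stmt-HodgeConjecture-24833
(supports-only helper; closes nothing by itself).  DEAL U8-4c-A of K2E1b-plan (g3) 2026-09-04T02:25:49Z («CUBIC CASIMIR LAWS: centrality +
class-invariance»), hand K2-defs1 (g3).  Sequel to the ★ DEFS LEAF `Theorems/K2E1bCubicCasimirDefs.lean` (D-U8-1: `upqCubicOp`, `HasCubicScalar`,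
`HasCubicPin`, `SameCubicPin`, `cubicOf`); THEOREMS ONLY — no definition, no `sorry`, no axiom, no instance (one
`attribute [local instance] LieRing.ofAssociativeRing`, the Mathlib idiom of every ★ `Upq*` ∕ E1b file), no notation.  It answers ADVISORY 3 of
the review of ★ p856708 («class-invariance of the pin (independence of the representative) is unproved») and is what socket 8b of TABLE ED. 8 §2d
consumes (`sameCubicPin_iff_of_hasCubicPin`).

## What is proved

* §0 (general: commutative ring `R`, finite `ι`, associative `R`-algebra `A`, commutator bracket): for a Lie algebra homomorphism
  `ρ : 𝔤𝔩(ι, R) → A` the image `C₃ = Σ_{i,j,k} ρ(E_{ij}) ρ(E_{jk}) ρ(E_{ki})` of the CUBIC GELFAND INVARIANT commutes with every `ρ(M)`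
  (`lieHom_matrix_comm_cubicSum`) — the cubic twin of ★ `Kovacevic2021.lieHom_matrix_comm_casimirSum` (Humphreys' Lemma §6.2 pattern):
  reduce to `M = E_{ab}`; `[ρE_{ab}, ·]` is a derivation of triple products; `[E_{ab}, E_{ij}] = δ_{bi} E_{aj} − δ_{ja} E_{ib}`; the three groups
  `(Σ_{jk} E_{aj}E_{jk}E_{kb} − Σ_{ik} E_{ib}E_{ak}E_{ki}) + (Σ_{ik} E_{ib}E_{ak}E_{ki} − Σ_{ij} E_{ij}E_{jb}E_{ai}) + (Σ_{ij} E_{ij}E_{jb}E_{ai} − Σ_{jk} E_{aj}E_{jk}E_{kb})`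
  telescope to `0` [Molev2007, §7.1; Zhelobenko 1973 §60].  No PBW, no Harish-Chandra isomorphism.
* §1 hence ★ `upqCubicOp ρ𝔤` commutes with the complexified action ★ `upqLieC ρ𝔤` of `𝔤𝔩(α ⊕ β, ℂ)` (`upqCubicOp_comm_upqLieC`, pointwise
  `upqCubicOp_upqLieC_apply`) and with the real action `ρ𝔤` of `𝔲(α, β)` (`upqCubicOp_comm_ρ𝔤`, `upqCubicOp_ρ𝔤_apply`).
* §2 TRANSPORT along an intertwiner: a `ℂ`-linear map `f` with `f (ρ𝔤 X v) = σ𝔤 X (f v)` intertwines `upqLieC` (`upqLieC_map`) and `C₃`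
  (`upqCubicOp_map`); along a linear EQUIVALENCE the cubic scalar is transported (`upqCubicOp_conj`, `HasCubicScalar.of_conj`, `hasCubicScalar_conj_iff`).
* §3 CLASS-INVARIANCE of the pin: `hasCubicPin_mk_iff : HasCubicPin (GKIrrClass.mk r) s ↔ HasCubicScalar r.ρ𝔤 s` (ANY representative, via
  ★ `GKIrrClass.mk_eq_mk_iff` → ★ `GKEquiv` → §2); **`HasCubicPin.unique : HasCubicPin x s → HasCubicPin x s' → s = s'`** (an irreducible
  `(𝔤, K)`-module is `Nontrivial`, ★ `IsIrreducibleGK`, so ★ `HasCubicScalar.unique` applies); `SameCubicPin.refl_of`, `SameCubicPin.trans`, and the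
  corollary **`sameCubicPin_iff_of_hasCubicPin (hy : HasCubicPin y s) : SameCubicPin x y ↔ HasCubicPin x s`** (the RELATIVE pin of the LEVEL-B′ sockets
  equals the absolute pin as soon as ONE pin of the reference class is known — e.g. after the calibration brick U8-4c (iii)).

NOT here (separate later brick U8-4c (iii), record internals): the calibration `HasCubicPin (dsClsOfRecord a b c j) (cubicOf a b c)`.

Sources: [Molev2007] A. Molev, *Yangians and Classical Lie Algebras*, AMS Surveys 143 (2007), §7.1 (Gelfand invariants `Σ E_{i₁i₂}E_{i₂i₃}⋯E_{i_k i₁}`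
are central in `U(𝔤𝔩_n)`); [Humphreys1972] §6.2 Lemma p. 27 (pattern of the telescoping proof, as in ★ `SU21CasimirCentral`); [KnappVogan1995] §II.4
(classes of irreducible `(𝔤, K)`-modules; an intertwiner transports the action of `U(𝔤)`); [BorelWallach2000] I §4.3.

HONEST LABEL: HC_CM is proved only modulo the 7 printed citations (2 remaining named inputs: hLiu418 = stmt-HodgeConjecture-24832,
h413 = stmt-HodgeConjecture-24833) until rung 0 closes; LAWS bricks close nothing by themselves.
-/

set_option autoImplicit false
set_option linter.dupNamespace false

noncomputable section

namespace Summit.HodgeConjecture.HodgeConjecture.Cruxes.H413.K2E1bGKCohomologyU21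

open Literature.NumberTheory.Automorphic
open Literature.RepresentationTheory
open Literature.RepresentationTheory.BorelWallach2000
open Literature.RepresentationTheory.KonnoKonno2007 Literature.RepresentationTheory.KonnoKonno2007.RealDualPair
open Literature.RepresentationTheory.KonnoKonno2007.RealDualPair.UForm

-- Mathlib idiom (as in `GKModules`, `GKCohomology`, the `Upq*` files, ★ `K2E1bCubicCasimirDefs`): commutator bracket on associative algebras
attribute [local instance 100] LieRing.ofAssociativeRing

/-! ## §0 The cubic Gelfand invariant of `𝔤𝔩(ι, R)` under a Lie algebra homomorphism is central -/

section MatrixCubic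

variable {R : Type*} [CommRing R] {A : Type*} [Ring A] [Algebra R A]
  {ι : Type*} [Fintype ι] [DecidableEq ι]

/-- The commutator of two matrix units: `[E_{ab}, E_{ij}] = δ_{bi} E_{aj} − δ_{ja} E_{ib}`. [folklore] -/
private theorem single_one_commutator (a b i j : ι) :
    Matrix.single a b (1 : R) * Matrix.single i j 1 - Matrix.single i j 1 * Matrix.single a b 1 =
      (if b = i then Matrix.single a j 1 else 0) - (if j = a then Matrix.single i b 1 else 0) := by
  congr 1
  · split_ifs with h
    · subst h; rw [Matrix.single_mul_single_same, mul_one]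
    · simp [Matrix.single_mul_single_of_ne, h]
  · split_ifs with h
    · subst h; rw [Matrix.single_mul_single_same, mul_one]
    · simp [Matrix.single_mul_single_of_ne, h]

/-- **The image of the cubic Gelfand invariant is central.**  For a Lie algebra homomorphism `ρ : 𝔤𝔩(ι, R) → A` into an associative algebra
(commutator bracket), `C₃ = Σ_{i,j,k} ρ(E_{ij}) ρ(E_{jk}) ρ(E_{ki})` commutes with every `ρ(M)`: reduce to matrix units, expand `[ρ(E_{ab}), ·]` as a
derivation of the triple products, use `[E_{ab}, E_{ij}] = δ_{bi} E_{aj} − δ_{ja} E_{ib}`, and the six resulting double sums cancel in pairs after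
relabelling. [cite: Molev2007, §7.1] [cite: Humphreys1972, §6.2 Lemma (p. 27)] -/
theorem lieHom_matrix_comm_cubicSum (ρ : Matrix ι ι R →ₗ⁅R⁆ A) (M : Matrix ι ι R) :
    ρ M * (∑ i, ∑ j, ∑ k, ρ (Matrix.single i j 1) * ρ (Matrix.single j k 1) * ρ (Matrix.single k i 1)) =
      (∑ i, ∑ j, ∑ k, ρ (Matrix.single i j 1) * ρ (Matrix.single j k 1) * ρ (Matrix.single k i 1)) * ρ M := by
  set C := ∑ i, ∑ j, ∑ k, ρ (Matrix.single i j 1) * ρ (Matrix.single j k 1) * ρ (Matrix.single k i 1) with hC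
  -- reduction to matrix units
  suffices h : ∀ a b : ι, ρ (Matrix.single a b 1) * C = C * ρ (Matrix.single a b 1) by
    have hM : ρ M = ∑ a, ∑ b, M a b • ρ (Matrix.single a b 1) := by
      conv_lhs => rw [Matrix.matrix_eq_sum_single M]
      simp only [map_sum]
      refine Finset.sum_congr rfl fun a _ => Finset.sum_congr rfl fun b _ => ?_
      rw [← map_smul, Matrix.smul_single, smul_eq_mul, mul_one]
    rw [hM, Finset.sum_mul, Finset.mul_sum]
    refine Finset.sum_congr rfl fun a _ => ?_
    rw [Finset.sum_mul, Finset.mul_sum]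
    refine Finset.sum_congr rfl fun b _ => ?_
    rw [smul_mul_assoc, mul_smul_comm, h a b]
  intro a b
  rw [← sub_eq_zero]
  set x := ρ (Matrix.single a b 1) with hx
  -- `[x, Σ p q r] = Σ ([x, p] q r + p [x, q] r + p q [x, r])`
  have expand : x * C - C * x =
      ∑ i, ∑ j, ∑ k, ((x * ρ (Matrix.single i j 1) - ρ (Matrix.single i j 1) * x)
            * ρ (Matrix.single j k 1) * ρ (Matrix.single k i 1)
        + ρ (Matrix.single i j 1) * (x * ρ (Matrix.single j k 1) - ρ (Matrix.single j k 1) * x)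
            * ρ (Matrix.single k i 1)
        + ρ (Matrix.single i j 1) * ρ (Matrix.single j k 1)
            * (x * ρ (Matrix.single k i 1) - ρ (Matrix.single k i 1) * x)) := by
    rw [hC, Finset.mul_sum, Finset.sum_mul, ← Finset.sum_sub_distrib]
    refine Finset.sum_congr rfl fun i _ => ?_
    rw [Finset.mul_sum, Finset.sum_mul, ← Finset.sum_sub_distrib]
    refine Finset.sum_congr rfl fun j _ => ?_
    rw [Finset.mul_sum, Finset.sum_mul, ← Finset.sum_sub_distrib]
    refine Finset.sum_congr rfl fun k _ => ?_
    noncomm_ring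
  -- the brackets are images of matrix commutators
  have br : ∀ i j : ι, x * ρ (Matrix.single i j 1) - ρ (Matrix.single i j 1) * x =
      (if b = i then ρ (Matrix.single a j 1) else 0) - (if j = a then ρ (Matrix.single i b 1) else 0) := by
    intro i j
    rw [hx, ← LieRing.of_associative_ring_bracket, ← LieHom.map_lie, LieRing.of_associative_ring_bracket,
      single_one_commutator, map_sub]
    congr 1 <;> split_ifs <;> simp
  rw [expand]
  simp only [br, sub_mul, mul_sub, ite_mul, zero_mul, mul_ite, mul_zero, Finset.sum_add_distrib,
    Finset.sum_sub_distrib, Finset.sum_ite_irrel, Finset.sum_const_zero, Finset.sum_ite_eq,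
    Finset.sum_ite_eq', Finset.mem_univ, if_true]
  rw [Finset.sum_comm (f := fun i k => ρ (Matrix.single i b 1) * ρ (Matrix.single a k 1) * ρ (Matrix.single k i 1))]
  abel

end MatrixCubic

/-! ## §1 `upqCubicOp` commutes with the complexified action and with `ρ𝔤` -/

section General

variable {α β : Type} [Fintype α] [DecidableEq α] [Fintype β] [DecidableEq β]
variable {V : Type*} [AddCommGroup V] [Module ℂ V] (ρ𝔤 : (uFormGroup α β).lie →ₗ⁅ℝ⁆ Module.End ℂ V)

/-- **`C₃` is central**: `upqCubicOp ρ𝔤` commutes with `ρ_ℂ(M)` for every `M ∈ 𝔤𝔩(α ⊕ β, ℂ)` (§0 applied to the Lie homomorphism ★ `upqLieC ρ𝔤`).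
[cite: Molev2007, §7.1] -/
theorem upqCubicOp_comm_upqLieC (M : Matrix (α ⊕ β) (α ⊕ β) ℂ) :
    upqCubicOp ρ𝔤 * upqLieC ρ𝔤 M = upqLieC ρ𝔤 M * upqCubicOp ρ𝔤 := by
  rw [upqCubicOp_eq]
  exact (lieHom_matrix_comm_cubicSum (upqLieC ρ𝔤) M).symm

/-- Pointwise form: `C₃ (ρ_ℂ(M) v) = ρ_ℂ(M) (C₃ v)`. [cite: Molev2007, §7.1] -/
theorem upqCubicOp_upqLieC_apply (M : Matrix (α ⊕ β) (α ⊕ β) ℂ) (v : V) :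
    upqCubicOp ρ𝔤 (upqLieC ρ𝔤 M v) = upqLieC ρ𝔤 M (upqCubicOp ρ𝔤 v) := by
  rw [← Module.End.mul_apply, upqCubicOp_comm_upqLieC, Module.End.mul_apply]

/-- `C₃` commutes with the real action: `upqCubicOp ρ𝔤 * ρ𝔤 X = ρ𝔤 X * upqCubicOp ρ𝔤` for `X ∈ 𝔲(α, β)` (★ `upqLieC_coe`). [cite: Molev2007, §7.1] -/
theorem upqCubicOp_comm_ρ𝔤 (X : (uFormGroup α β).lie) : upqCubicOp ρ𝔤 * ρ𝔤 X = ρ𝔤 X * upqCubicOp ρ𝔤 := by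
  rw [← upqLieC_coe ρ𝔤 X, upqCubicOp_comm_upqLieC]

/-- Pointwise form: `C₃ (ρ𝔤 X v) = ρ𝔤 X (C₃ v)` for `X ∈ 𝔲(α, β)`. [cite: Molev2007, §7.1] -/
theorem upqCubicOp_ρ𝔤_apply (X : (uFormGroup α β).lie) (v : V) : upqCubicOp ρ𝔤 (ρ𝔤 X v) = ρ𝔤 X (upqCubicOp ρ𝔤 v) := by
  rw [← Module.End.mul_apply, upqCubicOp_comm_ρ𝔤, Module.End.mul_apply]

/-- `C₃` commutes with a cubic-scalar module's `ρ_ℂ` in bracket form: `⁅ρ_ℂ(M), C₃⁆ = 0`. [cite: Molev2007, §7.1] -/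
theorem lie_upqLieC_upqCubicOp (M : Matrix (α ⊕ β) (α ⊕ β) ℂ) : ⁅upqLieC ρ𝔤 M, upqCubicOp ρ𝔤⁆ = 0 := by
  rw [LieRing.of_associative_ring_bracket, ← upqCubicOp_comm_upqLieC, sub_self]

/-! ## §2 Transport along an intertwiner -/

variable {W : Type*} [AddCommGroup W] [Module ℂ W] (σ𝔤 : (uFormGroup α β).lie →ₗ⁅ℝ⁆ Module.End ℂ W)

/-- An intertwiner of the real actions intertwines the complexified actions: `f (ρ_ℂ(M) v) = σ_ℂ(M) (f v)` (★ `upqLieC_apply`: `ρ_ℂ(M) = ρ𝔤(A M) + i ρ𝔤(B M)`).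
[cite: KnappVogan1995, §IV.1] -/
theorem upqLieC_map (f : V →ₗ[ℂ] W) (h : ∀ (X : (uFormGroup α β).lie) (v : V), f (ρ𝔤 X v) = σ𝔤 X (f v))
    (M : Matrix (α ⊕ β) (α ⊕ β) ℂ) (v : V) : f (upqLieC ρ𝔤 M v) = upqLieC σ𝔤 M (f v) := by
  rw [upqLieC_apply, upqLieC_apply, LinearMap.add_apply, LinearMap.add_apply, LinearMap.smul_apply, LinearMap.smul_apply,
    map_add, map_smul, h, h]

/-- An intertwiner of the real actions intertwines `C₃`: `f (C₃ v) = C₃ (f v)`. [cite: KnappVogan1995, §II.4] -/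
theorem upqCubicOp_map (f : V →ₗ[ℂ] W) (h : ∀ (X : (uFormGroup α β).lie) (v : V), f (ρ𝔤 X v) = σ𝔤 X (f v)) (v : V) :
    f (upqCubicOp ρ𝔤 v) = upqCubicOp σ𝔤 (f v) := by
  simp only [upqCubicOp_apply, map_sum, upqLieC_map ρ𝔤 σ𝔤 f h]

/-- **Transport of `C₃` along a linear equivalence** intertwining the real actions. [cite: KnappVogan1995, §II.4] -/
theorem upqCubicOp_conj (e : V ≃ₗ[ℂ] W) (h : ∀ (X : (uFormGroup α β).lie) (v : V), e (ρ𝔤 X v) = σ𝔤 X (e v)) :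
    ∀ v : V, e (upqCubicOp ρ𝔤 v) = upqCubicOp σ𝔤 (e v) :=
  upqCubicOp_map ρ𝔤 σ𝔤 (e : V →ₗ[ℂ] W) h

variable {ρ𝔤 σ𝔤} in
/-- **The cubic scalar is transported along an equivalence** of the real actions. [cite: KnappVogan1995, §II.4] -/
theorem HasCubicScalar.of_conj {s : ℂ} (e : V ≃ₗ[ℂ] W) (h : ∀ (X : (uFormGroup α β).lie) (v : V), e (ρ𝔤 X v) = σ𝔤 X (e v))
    (hs : HasCubicScalar ρ𝔤 s) : HasCubicScalar σ𝔤 s := by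
  intro w
  obtain ⟨v, rfl⟩ := e.surjective w
  rw [← upqCubicOp_conj ρ𝔤 σ𝔤 e h, hs v, map_smul]

/-- The intertwining relation passes to the inverse equivalence. [cite: KnappVogan1995, §II.4] -/
theorem intertwines_symm (e : V ≃ₗ[ℂ] W) (h : ∀ (X : (uFormGroup α β).lie) (v : V), e (ρ𝔤 X v) = σ𝔤 X (e v))
    (X : (uFormGroup α β).lie) (w : W) : e.symm (σ𝔤 X w) = ρ𝔤 X (e.symm w) := by
  apply e.injective
  rw [LinearEquiv.apply_symm_apply, h, LinearEquiv.apply_symm_apply]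

variable {ρ𝔤 σ𝔤} in
/-- Equivalent real actions have the same cubic scalars. [cite: KnappVogan1995, §II.4] -/
theorem hasCubicScalar_conj_iff {s : ℂ} (e : V ≃ₗ[ℂ] W) (h : ∀ (X : (uFormGroup α β).lie) (v : V), e (ρ𝔤 X v) = σ𝔤 X (e v)) :
    HasCubicScalar ρ𝔤 s ↔ HasCubicScalar σ𝔤 s :=
  ⟨fun hs => hs.of_conj e h, fun hs => hs.of_conj e.symm (intertwines_symm ρ𝔤 σ𝔤 e h)⟩

end General

/-! ## §3 The cubic pin is a class invariant -/

/-- **Representative-independence**: the class of `r` has cubic pin `s` iff `C₃ = s·1` on `r` itself (ANY representative computes the pin):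
two representatives are `(𝔤, K)`-equivalent (★ `GKIrrClass.mk_eq_mk_iff`), and an equivalence transports the cubic scalar (§2). [cite: KnappVogan1995, §II.4] -/
theorem hasCubicPin_mk_iff (r : GKIrrep (uFormGroup (Fin 2) (Fin 1))) (s : ℂ) :
    HasCubicPin (GKIrrClass.mk r) s ↔ HasCubicScalar r.ρ𝔤 s := by
  refine ⟨?_, hasCubicPin_mk r⟩
  rintro ⟨r', hr', hs'⟩
  obtain ⟨e⟩ := (GKIrrClass.mk_eq_mk_iff r' r).1 hr'
  exact hs'.of_conj e.toLinearEquiv e.map_ρ𝔤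

/-- **THE CUBIC PIN IS UNIQUE**: a class carries at most one cubic scalar — two representatives are `(𝔤, K)`-equivalent, the scalar is transported
(§2), and on the (non-zero: ★ `IsIrreducibleGK`) second representative ★ `HasCubicScalar.unique` applies. [cite: KnappVogan1995, §II.4] -/
theorem HasCubicPin.unique {x : GKIrrClass (uFormGroup (Fin 2) (Fin 1))} {s s' : ℂ} (h : HasCubicPin x s) (h' : HasCubicPin x s') : s = s' := by
  obtain ⟨r, rfl, hs⟩ := h
  have hs' : HasCubicScalar r.ρ𝔤 s' := (hasCubicPin_mk_iff r s').1 h'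
  haveI : Nontrivial r.V := r.isIrreducible.nontrivial
  obtain ⟨v, hv⟩ := exists_ne (0 : r.V)
  exact HasCubicScalar.unique r.ρ𝔤 hs hs' hv

/-- A pinned class has the same pin as itself. [folklore] -/
theorem SameCubicPin.refl_of {x : GKIrrClass (uFormGroup (Fin 2) (Fin 1))} {s : ℂ} (h : HasCubicPin x s) : SameCubicPin x x :=
  ⟨s, h, h⟩

/-- `SameCubicPin` is transitive (the middle class's pin is unique). [folklore] -/
theorem SameCubicPin.trans {x y z : GKIrrClass (uFormGroup (Fin 2) (Fin 1))} (hxy : SameCubicPin x y) (hyz : SameCubicPin y z) :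
    SameCubicPin x z := by
  obtain ⟨s, hx, hy⟩ := hxy
  obtain ⟨t, hy', hz⟩ := hyz
  obtain rfl : s = t := hy.unique hy'
  exact ⟨s, hx, hz⟩

/-- **RELATIVE PIN = ABSOLUTE PIN once the reference class is pinned**: if `y` has cubic pin `s`, then `x` has the same cubic pin as `y` iff `x` has
cubic pin `s` — the form in which socket 8b (TABLE ED. 8 §2d) consumes the LEVEL-B′ hypothesis `SameCubicPin x (dsClsOfRecord a b c 0)` after the
calibration brick. [folklore] -/
theorem sameCubicPin_iff_of_hasCubicPin {x y : GKIrrClass (uFormGroup (Fin 2) (Fin 1))} {s : ℂ} (hy : HasCubicPin y s) :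
    SameCubicPin x y ↔ HasCubicPin x s := by
  refine ⟨?_, fun hx => ⟨s, hx, hy⟩⟩
  rintro ⟨t, hxt, hyt⟩
  obtain rfl : t = s := hyt.unique hy
  exact hxt

/-- Symmetric form: `SameCubicPin y x ↔ HasCubicPin x s` for `y` pinned at `s`. [folklore] -/
theorem sameCubicPin_iff_of_hasCubicPin' {x y : GKIrrClass (uFormGroup (Fin 2) (Fin 1))} {s : ℂ} (hy : HasCubicPin y s) :
    SameCubicPin y x ↔ HasCubicPin x s :=
  ⟨fun h => (sameCubicPin_iff_of_hasCubicPin hy).1 h.symm, fun h => SameCubicPin.symm ((sameCubicPin_iff_of_hasCubicPin hy).2 h)⟩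

end Summit.HodgeConjecture.HodgeConjecture.Cruxes.H413.K2E1bGKCohomologyU21

end
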